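/-
Copyright (c) 2026 the pub-hodgecm-mathlib formalisation cell (harness21).  Prover seat hodgecm-mathlib-LH7-p04 (g8), E3a pen: layer (L2) of E3a, §1 (the uniform radius), after BOX
LHref-N LH2 #64 route (i) (CENSUS-E3a v1.1 §4).
-/
import Literature.NumberTheory.Rogawski1990.ArchEPAssemblyLocal      -- ★ (L1) p852251 `ballIdentity_of_readings` (the per-ball identity from the readings); brings ★ E3-CORE, `orbFamGExt`, `stableSumG`
import Literature.NumberTheory.Rogawski1990.ArchEPAssemblyPartition  -- ★ E3b p852221 (LH3-p04 (g7)): §4 `exists_epGenerator_choice` (generator choice functions at one definite place); brings ★ `EPGeneratorAt`, `esymm3`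
import Mathlib.Topology.MetricSpace.Pseudo.Lemmas
import Mathlib.Topology.MetricSpace.Pseudo.Pi
import HarnessLib

/-!
# EP assembly, layer (L2) §1: a uniform radius for the ball-by-ball transfer (Lebesgue number on the compact class image `K^D`)

Topic `NumberTheory/Rogawski1990`; namespace `Literature.NumberTheory.Rogawski1990`.  THEOREMS ONLY (no definition, no instance, no notation, no named fact, no `sorry`); kernel lane
`--supports stmt-HodgeConjecture-24833`.  Cell `pub/hodgecm-mathlib` (D-0151), crux H413; HCML «GO 500» road N8-INNER ROAD B «EP road» (owner LH2-plan (g1)), brick E3 «EP ASSEMBLY =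
H-S4′», layer (L2) `ballTransfer_fixed` (= the `hBall` of ★ E3-SUM ED.2 `stableSurjG_of_ballTransfer_fixed`, test function `a′` bound BEFORE the radii — BOX LHref-N LH2 #64 route (i)).
HONEST LABEL: count-neutral plumbing; HC_CM is proved only modulo the 7 printed citations (2 remaining: hLiu418 = stmt-HodgeConjecture-24832, h413 = stmt-HodgeConjecture-24833) until
rung 0 closes.

§1 THE UNIFORM RADIUS (this edition).  The three radii of a ball — (r1) the EP generator's radius and (r2) its `h ≠ 0` radius (★ E3b §4 `exists_epGenerator_choice`, centre by centre) and
(r3) the GT-local factorisation radius of the `I`-block coupling of `a′` (★ (B3) p852202, which depends on `a′` AND on the whole `D`-tuple of centres) — give a positive radius function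
`ρ` on the tuples of centres in `K^D`; since `K^D` is compact (`K = range (esymm3 ∘ cexp)`, ★ E3b `isCompact_range_esymm3_cexp`; `isCompact_univ_pi`), Mathlib's
`lebesgue_number_lemma_of_metric` on the sup-metric boxes `ball y (ρ y) = Π_v ball (y v) (ρ y)` (`ball_pi`) yields ONE `δ > 0` such that every box of radius `δ` centred on `K^D` sits inside
the `ρ`-box of some centre tuple `y ∈ K^D`: `exists_uniform_radius_pi`.  E3a sets `ε v b := δ` (constant) in `hBall` and, given `(ctr, F)` with `tsupport (F v) ⊆ ball (ctr v) δ`, runs the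
four readings with the generators and the GT chart of that `y` (§4, a later edition, from the co-hand slices hβ∕hgen∕hIT∕(s2)).
§2 (ED. 2) THE SMOOTH WEIGHT: `m := F · h⁻¹` is `C^∞` on the whole class space as soon as `tsupport F ⊆ {h ≠ 0}` (`contDiff_ofReal_mul_inv_of_tsupport_subset`; the weights `m_v = 2F_v∕h_v`
of HANDOFF-E3 §4, smooth because the PoU factor `F_v` lives inside the ball where the generator's `h_v ≠ 0`).
§3 (ED. 2) THE GENERATOR TUPLE: from the head's generic one-place hypothesis `hEP` (every elliptic class at every block place carries an EP generator, for the block's own Haar measures)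
the choice functions of ★ E3b §4 `exists_epGenerator_choice` for ALL block places at once (`exists_epGenerator_choice_pi`; `choose`).

## References
* [Rogawski1990] J. D. Rogawski, *Automorphic Representations of Unitary Groups in Three Variables*, Ann. of Math. Stud. 123 (1990), §14.2 (14.2.1) p. 232 (the transfer is assembled
  from finitely many local pieces).
* [Bouaziz1994IntegralesOrbitales] A. Bouaziz, *Intégrales orbitales sur les algèbres de Lie réductives*, Invent. Math. 115 (1994), §6.2 p. 591 (localisation on the class space).
-/

set_option autoImplicit false

open Set Metric Topology MeasureTheory NumberField NumberField.InfinitePlace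
open Literature.NumberTheory.Automorphic Literature.NumberTheory.Automorphic.UnitaryGroup
open scoped MatrixGroups Matrix ContDiff Classical

noncomputable section

namespace Literature.NumberTheory.Rogawski1990

/-! ## §1 The uniform radius -/

section UniformRadius

variable {ι : Type*} [Fintype ι] {X : Type*} [PseudoMetricSpace X]

/-- **A UNIFORM RADIUS ON `K^ι` (Lebesgue number of the `ρ`-boxes).**  `K` compact, `ρ` a radius function positive at every tuple of points of `K`: there is ONE `δ > 0` such that for every
tuple `x ∈ K^ι` some tuple `y ∈ K^ι` has `ball (x i) δ ⊆ ball (y i) (ρ y)` at EVERY index — Mathlib `lebesgue_number_lemma_of_metric` for the cover of the compact `Set.pi univ K` by the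
sup-metric balls `ball y (ρ y) = Set.pi univ (ball (y ·) (ρ y))` (`ball_pi`). [cite: Bouaziz1994IntegralesOrbitales, §6.2 p. 591] [cite: Rogawski1990, §14.2 p. 232] -/
theorem exists_uniform_radius_pi {K : Set X} (hK : IsCompact K) (ρ : (ι → X) → ℝ) (hρ : ∀ y : ι → X, (∀ i, y i ∈ K) → 0 < ρ y) :
    ∃ δ : ℝ, 0 < δ ∧ ∀ x : ι → X, (∀ i, x i ∈ K) → ∃ y : ι → X, (∀ i, y i ∈ K) ∧ ∀ i, ball (x i) δ ⊆ ball (y i) (ρ y) := by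
  have hS : IsCompact (Set.pi Set.univ fun _ : ι => K) := isCompact_univ_pi fun _ => hK
  obtain ⟨δ, hδ, hcov⟩ := lebesgue_number_lemma_of_metric hS (c := fun y : ↥(Set.pi Set.univ fun _ : ι => K) => ball (y : ι → X) (ρ y))
    (fun _ => isOpen_ball) fun x hx => Set.mem_iUnion.2 ⟨⟨x, hx⟩, mem_ball_self (hρ x fun i => hx i (Set.mem_univ i))⟩
  refine ⟨δ, hδ, fun x hx => ?_⟩
  obtain ⟨⟨y, hy⟩, hsub⟩ := hcov x fun i _ => hx i
  have hyK : ∀ i, y i ∈ K := fun i => hy i (Set.mem_univ i)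
  classical
  refine ⟨y, hyK, fun i z hz => ?_⟩
  -- move `x` to `z` in the `i`-th slot: still in the `δ`-box, hence in the `ρ y`-box of `y`
  have hmem : Function.update x i z ∈ ball x δ := by
    rw [ball_pi x hδ, Set.mem_univ_pi]
    intro j
    by_cases hj : j = i
    · subst hj; rw [Function.update_self]; exact hz
    · rw [Function.update_of_ne hj]; exact mem_ball_self hδ
  have h := hsub hmem
  rw [ball_pi y (hρ y hyK), Set.mem_univ_pi] at h
  have hi := h i
  rwa [Function.update_self] at hi

end UniformRadius

/-! ## §2 (ED. 2) The smooth weight `F · h⁻¹` -/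

section Weight

variable {E : Type*} [NormedAddCommGroup E] [NormedSpace ℝ E]

/-- **THE WEIGHT `F · h⁻¹` IS SMOOTH WHEN `F` LIVES WHERE `h ≠ 0`**: `F` real `C^∞`, `h` complex `C^∞`, `tsupport F ⊆ {h ≠ 0}` ⇒ `z ↦ F z · (h z)⁻¹` is `C^∞` (smooth quotient on the open set
`{h ≠ 0}`, identically `0` near every other point). [cite: Bouaziz1994IntegralesOrbitales, §6.2 p. 591] -/
theorem contDiff_ofReal_mul_inv_of_tsupport_subset {F : E → ℝ} {h : E → ℂ} (hF : ContDiff ℝ ∞ F) (hh : ContDiff ℝ ∞ h)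
    (hsupp : tsupport F ⊆ {z | h z ≠ 0}) : ContDiff ℝ ∞ fun z => (F z : ℂ) * (h z)⁻¹ := by
  refine contDiff_iff_contDiffAt.2 fun z => ?_
  by_cases hz : h z ≠ 0
  · exact (Complex.ofRealCLM.contDiff.comp hF).contDiffAt.mul (hh.contDiffAt.inv hz)
  · -- off `{h ≠ 0}`: outside the support of `F`, the weight vanishes near `z`
    have hz' : z ∉ tsupport F := fun h' => hz (hsupp h')
    have hev : (fun z => (F z : ℂ) * (h z)⁻¹) =ᶠ[𝓝 z] fun _ => 0 := by
      filter_upwards [notMem_tsupport_iff_eventuallyEq.1 hz'] with y hy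
      rw [hy, Pi.zero_apply, Complex.ofReal_zero, zero_mul]
    exact (contDiffAt_const (c := (0 : ℂ))).congr_of_eventuallyEq hev

/-- The HANDOFF-E3 weight `m := 2 F ∕ h` is smooth under the same support condition. [cite: Bouaziz1994IntegralesOrbitales, §6.2 p. 591] -/
theorem contDiff_weight_of_tsupport_subset {F : E → ℝ} {h : E → ℂ} (hF : ContDiff ℝ ∞ F) (hh : ContDiff ℝ ∞ h)
    (hsupp : tsupport F ⊆ {z | h z ≠ 0}) : ContDiff ℝ ∞ fun z => 2 * (F z : ℂ) * (h z)⁻¹ := by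
  have h2 := (contDiff_ofReal_mul_inv_of_tsupport_subset hF hh hsupp).const_smul (2 : ℂ)
  have he : (fun z => 2 * (F z : ℂ) * (h z)⁻¹) = fun z => (2 : ℂ) • ((F z : ℂ) * (h z)⁻¹) := by
    funext z; rw [smul_eq_mul, mul_assoc]
  rw [he]
  exact h2

end Weight

/-! ## §3 (ED. 2) The generator tuple over the block -/

section GeneratorTuple

-- the scoped `ℓ^∞`-operator norm on `M₃(ℂ)` (★ one-place convention for the ambient `fa`)
open scoped Matrix.Norms.Operator

variable (L : Type) [Field L] [NumberField L] [IsCMField L] (β : Fin 3 → L) {ι : Type*} (v : ι → {w : InfinitePlace L // IsComplex w})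
  [∀ k : ι, MeasurableSpace ↥(archLocal L 3 (Matrix.diagonal β) (v k))] [∀ k : ι, BorelSpace ↥(archLocal L 3 (Matrix.diagonal β) (v k))]
  (νw : ∀ k : ι, Measure ↥(archLocal L 3 (Matrix.diagonal β) (v k))) [∀ k, (νw k).IsHaarMeasure] [∀ k, (νw k).IsMulRightInvariant]

/-- **THE GENERATOR TUPLE**: if every elliptic class at every block place `v k` carries an EP generator for the measure `νw k` (`hEP`), there are choice functions `ε, f, h` indexed by the
block with the clauses of ★ E3b §4 `exists_epGenerator_choice` at every `k` (that theorem, `choose`n over the block). [cite: Rogawski1990, §8.2 p. 122; §14.2 (14.2.1) p. 232]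
[cite: Bouaziz1994IntegralesOrbitales, §6.2 p. 591] -/
theorem exists_epGenerator_choice_pi (hEP : ∀ (k : ι) (l : Fin 3 → ℂ), (∀ i, ‖l i‖ = 1) → EPGeneratorAt L β (v k) (νw k) (esymm3 l)) :
    ∃ (ε : ι → ℂ × ℂ × ℂ → ℝ) (f : ∀ k : ι, ℂ × ℂ × ℂ → ↥(archLocal L 3 (Matrix.diagonal β) (v k)) → ℂ) (h : ι → ℂ × ℂ × ℂ → ℂ × ℂ × ℂ → ℂ),
      (∀ k b, 0 < ε k b) ∧
      ∀ k, ∀ b ∈ (Set.range fun t : Fin 3 → ℝ => esymm3 fun i => Complex.exp ((t i : ℂ) * Complex.I)),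
        (∃ fa : Matrix (Fin 3) (Fin 3) ℂ → ℂ, ContDiff ℝ ∞ fa ∧ ∀ g, f k b g = fa ((g : GL (Fin 3) ℂ) : Matrix (Fin 3) (Fin 3) ℂ)) ∧ HasCompactSupport (f k b) ∧
        ContDiff ℝ ∞ (h k b) ∧ (∀ z, dist z b < ε k b → h k b z ≠ 0) ∧
        (∀ (S' : Finset {w : InfinitePlace L // IsComplex w}) (c : {w : InfinitePlace L // IsComplex w} → Fin 3 → ℝ),
            v k ∈ S' → c (v k) 0 ≠ 0 → dist (bzClassMapG S' c (v k)) b < ε k b → chartOrbGLoc L β (v k) S' (νw k) (f k b) (c (v k)) = 0) ∧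
        (∀ (S' : Finset {w : InfinitePlace L // IsComplex w}) (c : {w : InfinitePlace L // IsComplex w} → Fin 3 → ℝ),
            v k ∉ S' → (Function.Injective fun i : Fin 3 => Circle.exp (c (v k) i)) → dist (bzClassMapG S' c (v k)) b < ε k b →
              ∑ σ : Equiv.Perm (Fin 3), chartOrbGLoc L β (v k) S' (νw k) (f k b) (c (v k) ∘ σ) = h k b (bzClassMapG S' c (v k))) := by
  choose ε f h hε hcl using fun k => exists_epGenerator_choice L β (v k) (νw k) (hEP k)
  exact ⟨ε, f, h, hε, hcl⟩

end GeneratorTuple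

end Literature.NumberTheory.Rogawski1990
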